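import Literature.NumberTheory.Automorphic.Liu2021.AppendixC.OmegaHomBlockCharacters
import Literature.AlgebraicGeometry.ComplexMultiplication.DualTateComparisonBaseChange
import Literature.LinearAlgebra.BaseChange.SemilinearAutOfIsBaseChange
import Literature.RingTheory.SimpleModule.MultiplicityFreeImageAdjoin
import Literature.RingTheory.Idempotents.CentreBlockFieldOfSemisimple
import Literature.FieldTheory.AlgClosed.AutomorphismExtension
import Literature.NumberTheory.GaloisRepresentations.PadicComplexEmbedding
import Mathlib.RingTheory.Algebraic.Cardinality
import Mathlib.SetTheory.Cardinal.Rat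
import HarnessLib

/-!
# [Liu 2021, App. D §D.4 / Prop. D.4 (1)] the `ε`-block of the Hecke image, III: `Aut(ℚ̄_ℓ/ℚ)`-transport along the `ℚ`-form,
# conjugacy of all blocks with the block of `ω⋆`, and THE (MO) PRODUCER `exists_block_multOne` (piece 3 of 3)

Topic `NumberTheory/Automorphic/Liu2021/AppendixC`; namespace `…AppendixC.Sec42Data.HeckeTranslates`.  Theorems only — no definition, no named
fact, no instance, no `sorry`.  Continues ★ `OmegaHomBlockCarrier` / ★ `OmegaHomBlockCharacters` (abstract carrier `(W_ε, iW, act′)` pinned by `hW`,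
`hact`; `A := ℚ̄_ℓ⟨range act′⟩`).  Co-produced with A-p05 (g12) (cell hodgecm-mathlib; his monolith is the twin road).
* §4 `exists_semilinear_transport_blockCarrier` — from a `ℚ`-form `(ψ, c, hc)` of `V_ℓ(A_K)` (★ `exists_ratRep_tateComparison`): for every
  automorphism `θ` of `ℚ̄_ℓ` a `θ`-semilinear bijection of `W_ε` (with its `θ⁻¹`-semilinear inverse) commuting with every `act′ h`
  (★ `exists_isBaseChange_dualTateComparison`, ★ `SemilinearAutOfIsBaseChange`).
* §5 `finrank_center_mul_finrank_adjoin_blockCarrier_eq_sq` — ALL BLOCKS ARE CONJUGATE TO THE BLOCK OF `ω⋆`: the character `τ_c` of a component is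
  carried to `τ₀` by some `θ` (★ `exists_ringEquiv_apply_eq`; `#ℚ̄_ℓ = 𝔠`, `#R₀ ≤ ℵ₀`), the transport carries the `τ_c`-eigenspace onto the SIMPLE `N₀′`
  (★ `mem_omegaBlock_of_forall_eigen`, ★ `eq_bot_or_eq_map_of_forall_stable`), so every component is simple (`hmf`) of dimension `dim N₀′` (`hd`);
  ★ `finrank_center_mul_finrank_adjoin_eq_sq_of_multiplicityFree` gives `dim Z(A) · dim A = (dim W_ε)²`.
* §6 **`exists_block_multOne`** — the S2′ (MO) socket (A-p11 probe `SocketMultOne`; d6 registered stub `stub_MO`), σ-FREE binder list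
  `T K hI X hX ι ρW hf hf0 σ hσ hD hHK hssM hεH hεcp hεc hsel ψ c hc hm1`; conclusion = the `hMO` text of ★ `finrank_mul_finrank_range_eq_sq_of_exists_block`.
HC_CM is proved only modulo the 7 printed citations until rung 0 closes; this file moves no book.  References: [Liu2021] §4.2 (FJcycle.tex
l. 2162–2165), Prop. D.4 (1) p. 130, App. D §D.4 pp. 139–140; [Milne2017] Prop. 4.31, Cor. 4.34; [Lorenz2008] Ch. 28 F20; [Lam2001FirstCourse] §22.
-/

set_option autoImplicit false

noncomputable section

open CategoryTheory NumberField Function Cardinal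
open scoped TensorProduct Cardinal

namespace Literature.NumberTheory.Automorphic.Liu2021.AppendixC

open Literature.AlgebraicGeometry.Motives (AbelianVariety)
open Literature.AlgebraicGeometry.Motives.AbelianVariety (rationalTateModuleMap endAlgebra rationalTateAction)

variable {F E : Type} [Field F] [NumberField F] [IsTotallyReal F] [Field E] [NumberField E] [Algebra F E]
  [IsTotallyComplex E] [Algebra.IsQuadraticExtension F E]
variable {P5 : PropC5Data F E} {isotropicAt : ℕ → Prop}

namespace Sec42Data.HeckeTranslates

variable {C : Sec42Data P5 isotropicAt} (T : C.HeckeTranslates) {ℓ : ℕ} [Fact ℓ.Prime]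
variable (K : C5.SmallLevel C.S.K₀)
  (hI : ∀ ⦃K K' : C5.SmallLevel C.S.K₀⦄ (f : K' ⟶ K), Function.Injective (rationalTateModuleMap ℓ (C.Atr f)).dualMap)
  (X : C.EtaleHeckeDatum ℓ) (hX : X.rhoEt = T.etHeckeRep ℓ) (ι : ℂ ≃+* AlgebraicClosure ℚ_[ℓ])
  {W : Type} [AddCommGroup W] [Module ℂ W] (ρW : Representation ℂ C.G W)
  {f : W →ₛₗ[(ι : ℂ →+* AlgebraicClosure ℚ_[ℓ])] AlgebraicClosure ℚ_[ℓ] ⊗[ℚ_[ℓ]] C.etaleH1Tower ℓ} (hf : f ∈ X.omegaHom ι ρW)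
  (σ : Representation (AlgebraicClosure ℚ_[ℓ]) C.G (AlgebraicClosure ℚ_[ℓ] ⊗[ℚ_[ℓ]] C.etaleH1Tower ℓ))
  (hσ : ∀ g : C.G, σ g = (X.rhoEt g).baseChange (AlgebraicClosure ℚ_[ℓ]))

section Characters

variable {Wε : Type} [AddCommGroup Wε] [Module (AlgebraicClosure ℚ_[ℓ]) Wε]
  (iW : Wε →ₗ[AlgebraicClosure ℚ_[ℓ]] AlgebraicClosure ℚ_[ℓ] ⊗[ℚ_[ℓ]] C.etaleH1 ℓ K) (hiW : Function.Injective iW)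

/-! ## §4 The `θ ⊗ 1` transport on the block carrier (from the `ℚ`-form of `H¹`) -/

section Transport

variable {hD : T.IsogenyDescent} (act' : ↥(T.heckeImage hD K) → Module.End (AlgebraicClosure ℚ_[ℓ]) Wε)
  (hact : ∀ (h : ↥(T.heckeImage hD K)) (w : Wε),
    iW (act' h w) = ((rationalTateAction (C.A K) ℓ (h : (C.A K).endAlgebra)).dualMap).baseChange (AlgebraicClosure ℚ_[ℓ]) (iW w))

include hiW hact in
/-- **The `Aut(ℚ̄_ℓ)`-transport on the block carrier.**  A `ℚ`-form of `V_ℓ(A_K)` on which `End⁰(A_K)` acts through rational matrices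
(`ψ`, `c`, `hc` — ★ `exists_ratRep_tateComparison`) gives, for every field automorphism `θ` of `ℚ̄_ℓ`, a `θ`-semilinear bijection `Θ_θ` of
`ℚ̄_ℓ ⊗ H¹_ét(A_K)` commuting with every `ᵗV_ℓ^ℚ x ⊗ 1` (★ `exists_isBaseChange_dualTateComparison`, ★ `exists_semilinear_addEquiv_of_isBaseChange`);
it preserves `range (ᵗV_ℓ^ℚ ε ⊗ 1) = iW(W_ε)` and so restricts, with its inverse, to a `θ`-semilinear bijection of `W_ε` commuting with every
`act′ h` («the action of `Aut(ℂ/ℚ)` permutes the blocks», [Liu2021] §4.2 l. 2162–2165 / App. D p. 140).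
[cite: Liu2021, §4.2 (FJcycle.tex l. 2162–2165) and App. D §D.4 p. 140] [cite: Milne2017, Prop. 4.31 and Cor. 4.34] -/
theorem exists_semilinear_transport_blockCarrier {κ : Type} [Fintype κ] [DecidableEq κ]
    (ψ : (C.A K).endAlgebra →ₐ[ℚ] Matrix κ κ ℚ) (c : (κ → ℚ_[ℓ]) ≃ₗ[ℚ_[ℓ]] (C.A K).rationalTateModule ℓ)
    (hc : ∀ x : (C.A K).endAlgebra,
      (c : (κ → ℚ_[ℓ]) →ₗ[ℚ_[ℓ]] (C.A K).rationalTateModule ℓ) ∘ₗ Matrix.mulVecLin ((ψ x).map (algebraMap ℚ ℚ_[ℓ])) =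
        (rationalTateAction (C.A K) ℓ x : Module.End ℚ_[ℓ] ((C.A K).rationalTateModule ℓ)) ∘ₗ
          (c : (κ → ℚ_[ℓ]) →ₗ[ℚ_[ℓ]] (C.A K).rationalTateModule ℓ))
    {ε : (C.A K).endAlgebra}
    (hW : LinearMap.range iW = LinearMap.range (((rationalTateAction (C.A K) ℓ ε).dualMap).baseChange (AlgebraicClosure ℚ_[ℓ])))
    (θ : AlgebraicClosure ℚ_[ℓ] ≃+* AlgebraicClosure ℚ_[ℓ]) :
    ∃ (Θ : Wε →ₛₗ[(θ : AlgebraicClosure ℚ_[ℓ] →+* AlgebraicClosure ℚ_[ℓ])] Wε)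
      (Θ' : Wε →ₛₗ[(θ.symm : AlgebraicClosure ℚ_[ℓ] →+* AlgebraicClosure ℚ_[ℓ])] Wε),
      (∀ w, Θ' (Θ w) = w) ∧ (∀ w, Θ (Θ' w) = w) ∧
      (∀ (h : ↥(T.heckeImage hD K)) (w : Wε), Θ (act' h w) = act' h (Θ w)) ∧
      ∀ (h : ↥(T.heckeImage hD K)) (w : Wε), Θ' (act' h w) = act' h (Θ' w) := by
  classical
  obtain ⟨op, hop⟩ : ∃ op : (C.A K).endAlgebra →
      Module.End (AlgebraicClosure ℚ_[ℓ]) (AlgebraicClosure ℚ_[ℓ] ⊗[ℚ_[ℓ]] C.etaleH1 ℓ K),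
      op = fun x => ((rationalTateAction (C.A K) ℓ x).dualMap).baseChange (AlgebraicClosure ℚ_[ℓ]) := ⟨_, rfl⟩
  have hop' : ∀ x, op x = ((rationalTateAction (C.A K) ℓ x).dualMap).baseChange (AlgebraicClosure ℚ_[ℓ]) := fun x => by rw [hop]
  have hact' : ∀ (h : ↥(T.heckeImage hD K)) (w : Wε), iW (act' h w) = op (h : (C.A K).endAlgebra) (iW w) :=
    fun h w => by rw [hop']; exact hact h w
  have hW' : LinearMap.range iW = LinearMap.range (op ε) := by rw [hop']; exact hW
  -- the `ℚ`-form and the `θ`-semilinear bijection `ΘM` of `M`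
  obtain ⟨j₀, hj₀, hj₀op⟩ :=
    Literature.AlgebraicGeometry.ComplexMultiplication.exists_isBaseChange_dualTateComparison (C.A K) ℓ ψ c hc
  have hE : ∀ (x : (C.A K).endAlgebra) (v : Module.Dual ℚ (κ → ℚ)), op x (j₀ v) = j₀ ((Matrix.mulVecLin (ψ x)).dualMap v) :=
    fun x v => by rw [hop']; exact hj₀op x v
  obtain ⟨ΘM, hΘM, hΘMj⟩ := Literature.LinearAlgebra.BaseChange.exists_semilinear_addEquiv_of_isBaseChange hj₀ θ
  have hcomm : ∀ (x : (C.A K).endAlgebra) (m : AlgebraicClosure ℚ_[ℓ] ⊗[ℚ_[ℓ]] C.etaleH1 ℓ K), ΘM (op x m) = op x (ΘM m) :=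
    fun x m => Literature.LinearAlgebra.BaseChange.semilinear_apply_comm_of_isBaseChange hj₀ θ ΘM hΘM hΘMj (op x)
      ((Matrix.mulVecLin (ψ x)).dualMap) (hE x) m
  have hcomm' : ∀ (x : (C.A K).endAlgebra) (m : AlgebraicClosure ℚ_[ℓ] ⊗[ℚ_[ℓ]] C.etaleH1 ℓ K),
      ΘM.symm (op x m) = op x (ΘM.symm m) :=
    fun x m => Literature.LinearAlgebra.BaseChange.semilinear_symm_apply_comm_of_isBaseChange hj₀ θ ΘM hΘM hΘMj (op x)
      ((Matrix.mulVecLin (ψ x)).dualMap) (hE x) m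
  have hΘM' : ∀ (z : AlgebraicClosure ℚ_[ℓ]) (m : AlgebraicClosure ℚ_[ℓ] ⊗[ℚ_[ℓ]] C.etaleH1 ℓ K), ΘM.symm (z • m) = θ.symm z • ΘM.symm m :=
    Literature.LinearAlgebra.BaseChange.semilinear_addEquiv_symm_smul θ ΘM hΘM
  -- both preserve `range iW = range (op ε)`
  have hstab : ∀ m ∈ LinearMap.range iW, ΘM m ∈ LinearMap.range iW := by
    intro m hm
    rw [hW'] at hm ⊢
    obtain ⟨m', rfl⟩ := hm
    exact ⟨ΘM m', (hcomm ε m').symm⟩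
  have hstab' : ∀ m ∈ LinearMap.range iW, ΘM.symm m ∈ LinearMap.range iW := by
    intro m hm
    rw [hW'] at hm ⊢
    obtain ⟨m', rfl⟩ := hm
    exact ⟨ΘM.symm m', (hcomm' ε m').symm⟩
  -- lifting along the injective `iW`
  have hlift : ∀ m ∈ LinearMap.range iW, ∃ w : Wε, iW w = m := fun m hm => LinearMap.mem_range.1 hm
  choose lift hlift' using hlift
  refine ⟨{ toFun := fun w => lift (ΘM (iW w)) (hstab _ (LinearMap.mem_range_self iW w))
            map_add' := fun w₁ w₂ => hiW (by simp only [hlift', map_add])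
            map_smul' := fun z w => hiW (by simp only [hlift', map_smul, hΘM, RingHom.coe_coe]) },
          { toFun := fun w => lift (ΘM.symm (iW w)) (hstab' _ (LinearMap.mem_range_self iW w))
            map_add' := fun w₁ w₂ => hiW (by simp only [hlift', map_add])
            map_smul' := fun z w => hiW (by simp only [hlift', map_smul, hΘM', RingHom.coe_coe]) },
          fun w => hiW ?_, fun w => hiW ?_, fun h w => hiW ?_, fun h w => hiW ?_⟩
  · simp only [LinearMap.coe_mk, AddHom.coe_mk, hlift', ΘM.symm_apply_apply]
  · simp only [LinearMap.coe_mk, AddHom.coe_mk, hlift', ΘM.apply_symm_apply]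
  · simp only [LinearMap.coe_mk, AddHom.coe_mk, hlift', hact', hcomm]
  · simp only [LinearMap.coe_mk, AddHom.coe_mk, hlift', hact', hcomm']

end Transport

/-! ## §5 Every block is conjugate to the block of `ω⋆`: multiplicity-freeness and the (MO) dimension identity -/

section Assembly

variable {hD : T.IsogenyDescent} (act' : ↥(T.heckeImage hD K) → Module.End (AlgebraicClosure ℚ_[ℓ]) Wε)
  (hact : ∀ (h : ↥(T.heckeImage hD K)) (w : Wε),
    iW (act' h w) = ((rationalTateAction (C.A K) ℓ (h : (C.A K).endAlgebra)).dualMap).baseChange (AlgebraicClosure ℚ_[ℓ]) (iW w))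

/-- A number field is countable. [folklore] -/
private theorem cardinalMk_numberField_le_aleph0 (R₀ : Type) [Field R₀] [NumberField R₀] : #R₀ ≤ ℵ₀ := by
  have h := Algebra.IsAlgebraic.cardinalMk_le_max ℚ R₀
  rw [Cardinal.mkRat, max_self] at h
  exact h

include hI hX hf hσ hiW hact in
/-- **ALL BLOCKS OF `W_ε` ARE CONJUGATE TO THE BLOCK OF `ω⋆`; HENCE `W_ε` IS MULTIPLICITY-FREE WITH EQUIDIMENSIONAL BLOCKS, and
`dim Z(A) · dim A = (dim W_ε)²`** for `A = ℚ̄_ℓ⟨act′(H)⟩` ([Liu2021] App. D §D.4, p. 140: «the action of `Aut(ℂ/ℚ)` … all blocks are conjugate», with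
Prop. D.4 (1) multiplicity one).  For an isotypic component `c` of `W_ε` with character `τ_c` (★ `exists_character_blockCarrier`) choose
`θ ∈ Aut(ℚ̄_ℓ)` with `θ ∘ τ_c = τ₀` (★ `exists_ringEquiv_apply_eq`: embeddings of the countable `R₀` into `ℚ̄_ℓ`, `#ℚ̄_ℓ = 𝔠`, are conjugate); the transport
`Θ_θ` (★ `exists_semilinear_transport_blockCarrier`) carries the `τ_c`-eigenspace INTO the `τ₀`-eigenspace `= N₀′` (★ `mem_omegaBlock_of_forall_eigen`) and
`Θ_θ⁻¹` carries `N₀′` back into it, so `c =` the `τ_c`-eigenspace is a `θ`-semilinear copy of the SIMPLE `N₀′` (★ `eq_bot_or_eq_map_of_forall_stable`):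
`c` is simple (`hmf`) of `ℚ̄_ℓ`-dimension `dim N₀′` (`hd`); then ★ `finrank_center_mul_finrank_adjoin_eq_sq_of_multiplicityFree`.
[cite: Liu2021, App. D §D.4 p. 140 (FJcycle.tex l. 5626–5631) and Prop. D.4 (1) (p. 130)] [cite: Lorenz2008, Ch. 28 F20 (Jacobson density with Schur's lemma)]
[cite: Lam2001FirstCourse, §22 Prop. (22.1)–(22.2) (pp. 327–328)] -/
theorem finrank_center_mul_finrank_adjoin_blockCarrier_eq_sq [ρW.IsIrreducible] [FiniteDimensional (AlgebraicClosure ℚ_[ℓ]) Wε]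
    (hHK : IsSemisimpleRing ↥(T.heckeImage hD K))
    (hssM : ∀ K' : C5.SmallLevel C.S.K₀,
      IsSemisimpleModule ↥(Algebra.adjoin (AlgebraicClosure ℚ_[ℓ])
        ((Set.range fun g : C.G => ((rationalTateAction (C.A K') ℓ (T.heckeEnd hD K' g)).dualMap).baseChange (AlgebraicClosure ℚ_[ℓ])) :
          Set (Module.End (AlgebraicClosure ℚ_[ℓ]) (AlgebraicClosure ℚ_[ℓ] ⊗[ℚ_[ℓ]] C.etaleH1 ℓ K'))))
        (AlgebraicClosure ℚ_[ℓ] ⊗[ℚ_[ℓ]] C.etaleH1 ℓ K'))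
    (hf0 : ∃ w ∈ ρW.fixedPoints (K.1.1 : Subgroup C.G), f w ≠ 0)
    {ε : (C.A K).endAlgebra} (hε : IsIdempotentElem ε) (hεH : ε ∈ T.heckeImage hD K)
    (hsel : ∀ w ∈ ρW.fixedPoints (K.1.1 : Subgroup C.G), ∀ x : (AlgebraicClosure ℚ_[ℓ]) ⊗[ℚ_[ℓ]] C.etaleH1 ℓ K,
        (C.toTower ℓ K).baseChange (AlgebraicClosure ℚ_[ℓ]) x = f w →
          (C.toTower ℓ K).baseChange (AlgebraicClosure ℚ_[ℓ])
            (((rationalTateAction (C.A K) ℓ ε).dualMap).baseChange (AlgebraicClosure ℚ_[ℓ]) x) = f w)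
    {R₀ : Type} [Field R₀] [NumberField R₀] (φ : R₀ →ₗ[ℚ] (C.A K).endAlgebra) (hφmul : ∀ a b, φ (a * b) = φ a * φ b)
    (hφ1 : φ 1 = ε) (hφH : ∀ r, φ r ∈ T.heckeImage hD K) (hφc : ∀ r, ∀ h ∈ T.heckeImage hD K, φ r * h = h * φ r)
    (hφsurj : ∀ z ∈ T.heckeImage hD K, (∀ y ∈ T.heckeImage hD K, z * y = y * z) → ∃ r : R₀, φ r = z * ε)
    {κ : Type} [Fintype κ] [DecidableEq κ]
    (ψ : (C.A K).endAlgebra →ₐ[ℚ] Matrix κ κ ℚ) (c : (κ → ℚ_[ℓ]) ≃ₗ[ℚ_[ℓ]] (C.A K).rationalTateModule ℓ)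
    (hc : ∀ x : (C.A K).endAlgebra,
      (c : (κ → ℚ_[ℓ]) →ₗ[ℚ_[ℓ]] (C.A K).rationalTateModule ℓ) ∘ₗ Matrix.mulVecLin ((ψ x).map (algebraMap ℚ ℚ_[ℓ])) =
        (rationalTateAction (C.A K) ℓ x : Module.End ℚ_[ℓ] ((C.A K).rationalTateModule ℓ)) ∘ₗ
          (c : (κ → ℚ_[ℓ]) →ₗ[ℚ_[ℓ]] (C.A K).rationalTateModule ℓ))
    (hm1 : ∀ f₁ ∈ X.omegaHom ι ρW, ∃ a : AlgebraicClosure ℚ_[ℓ], f₁ = a • f)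
    (hW : LinearMap.range iW = LinearMap.range (((rationalTateAction (C.A K) ℓ ε).dualMap).baseChange (AlgebraicClosure ℚ_[ℓ]))) :
    Module.finrank (AlgebraicClosure ℚ_[ℓ]) ↥(Algebra.adjoin (AlgebraicClosure ℚ_[ℓ]) (Set.range act') ⊓
          Subalgebra.centralizer (AlgebraicClosure ℚ_[ℓ])
            (Algebra.adjoin (AlgebraicClosure ℚ_[ℓ]) (Set.range act') : Set (Module.End (AlgebraicClosure ℚ_[ℓ]) Wε))) *
        Module.finrank (AlgebraicClosure ℚ_[ℓ]) ↥(Algebra.adjoin (AlgebraicClosure ℚ_[ℓ]) (Set.range act')) =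
      Module.finrank (AlgebraicClosure ℚ_[ℓ]) Wε ^ 2 := by
  classical
  -- the simple sub-block `N₀` of `ω⋆` and its character `τ₀`
  obtain ⟨N₀, hN₀simple, hN₀mem⟩ := T.exists_simple_omegaBlock K hI X hX ι ρW hf iW hiW hD hf0 hsel hW act' hact
  haveI := hN₀simple
  have hN0 : N₀ ≠ ⊥ := by
    intro h
    haveI := IsSimpleModule.nontrivial ↥(Algebra.adjoin (AlgebraicClosure ℚ_[ℓ]) (Set.range act')) ↥N₀
    obtain ⟨⟨x, hx⟩, hx0⟩ := exists_ne (0 : ↥N₀)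
    rw [h, Submodule.mem_bot] at hx
    exact hx0 (Subtype.ext hx)
  obtain ⟨τ₀, hτ₀, -⟩ := T.exists_character_blockCarrier K iW hiW act' hact hε hεH hW φ hφmul hφ1 hφH hφc N₀
  -- `A`-submodules are `act′`-stable subspaces: the atom `N₀` has no non-zero proper `act′`-stable subspace
  have hN₀atom : IsAtom N₀ := isSimpleModule_iff_isAtom.1 hN₀simple
  have hN₀stab : ∀ s ∈ Set.range act', ∀ w ∈ N₀.restrictScalars (AlgebraicClosure ℚ_[ℓ]), s w ∈ N₀.restrictScalars (AlgebraicClosure ℚ_[ℓ]) :=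
    Literature.NumberTheory.Automorphic.forall_mem_restrictScalars_of_submodule_adjoin (Set.range act') N₀
  have hN₀noproper : ∀ U : Submodule (AlgebraicClosure ℚ_[ℓ]) Wε, U ≤ N₀.restrictScalars (AlgebraicClosure ℚ_[ℓ]) →
      (∀ s ∈ Set.range act', ∀ u ∈ U, s u ∈ U) → U = ⊥ ∨ U = N₀.restrictScalars (AlgebraicClosure ℚ_[ℓ]) := by
    intro U hU hUS
    obtain ⟨U', hU'⟩ := Literature.NumberTheory.Automorphic.exists_submodule_adjoin_of_forall_mem (Set.range act') U hUS
    have hle : U' ≤ N₀ := fun x hx => by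
      have : x ∈ U'.restrictScalars (AlgebraicClosure ℚ_[ℓ]) := hx
      rw [hU'] at this
      exact hU this
    rcases hN₀atom.le_iff.1 hle with h | h
    · left; rw [← hU', h]; rfl
    · right; rw [← hU', h]
  -- cardinal bookkeeping for the transitivity of `Aut(ℚ̄_ℓ)` on the embeddings `R₀ → ℚ̄_ℓ`
  have hΩ : ℵ₀ < #(AlgebraicClosure ℚ_[ℓ]) := by
    rw [Literature.NumberTheory.GaloisRepresentations.NumberField.cardinalMk_algebraicClosure_padic]
    exact Cardinal.aleph0_lt_continuum
  have hR₀ : #R₀ ≤ ℵ₀ := cardinalMk_numberField_le_aleph0 R₀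
  -- semisimplicity and finiteness of the set of components
  haveI := T.isSemisimpleModule_blockCarrier K iW hiW hD hssM act' hact
  haveI : Fintype (isotypicComponents ↥(Algebra.adjoin (AlgebraicClosure ℚ_[ℓ]) (Set.range act')) Wε) :=
    (finite_isotypicComponents_blockCarrier (Wε := Wε) (Algebra.adjoin (AlgebraicClosure ℚ_[ℓ]) (Set.range act'))).fintype
  -- THE KEY: every component is `act′`-simple of dimension `dim N₀`
  have key : ∀ cc : isotypicComponents ↥(Algebra.adjoin (AlgebraicClosure ℚ_[ℓ]) (Set.range act')) Wε,
      IsSimpleModule ↥(Algebra.adjoin (AlgebraicClosure ℚ_[ℓ]) (Set.range act'))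
        ((cc : Submodule ↥(Algebra.adjoin (AlgebraicClosure ℚ_[ℓ]) (Set.range act')) Wε)) ∧
      Module.finrank (AlgebraicClosure ℚ_[ℓ]) ((cc : Submodule ↥(Algebra.adjoin (AlgebraicClosure ℚ_[ℓ]) (Set.range act')) Wε)) =
        Module.finrank (AlgebraicClosure ℚ_[ℓ]) ↥N₀ := by
    intro cc
    obtain ⟨N, hN, hcc⟩ := cc.2
    haveI := hN
    have hcc0 : (cc : Submodule ↥(Algebra.adjoin (AlgebraicClosure ℚ_[ℓ]) (Set.range act')) Wε) ≠ ⊥ :=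
      (bot_lt_isotypicComponents cc.2).ne'
    -- the character of `N` and the `τ`-eigenspace `Eτ ⊇ cc`
    obtain ⟨τ, -, hτc⟩ := T.exists_character_blockCarrier K iW hiW act' hact hε hεH hW φ hφmul hφ1 hφH hφc N
    obtain ⟨Eτ, hEτ⟩ : ∃ Eτ : Submodule (AlgebraicClosure ℚ_[ℓ]) Wε, ∀ w, w ∈ Eτ ↔ ∀ r : R₀, act' ⟨φ r, hφH r⟩ w = τ r • w :=
      ⟨{ carrier := {w | ∀ r : R₀, act' ⟨φ r, hφH r⟩ w = τ r • w}
         add_mem' := fun {a b} ha hb r => by rw [map_add, ha r, hb r, smul_add]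
         zero_mem' := fun r => by rw [map_zero, smul_zero]
         smul_mem' := fun z w hw r => by
           change act' ⟨φ r, hφH r⟩ (z • w) = τ r • z • w
           rw [map_smul, hw r, smul_comm] }, fun w => Iff.rfl⟩
    have hccE : ∀ w, w ∈ (cc : Submodule ↥(Algebra.adjoin (AlgebraicClosure ℚ_[ℓ]) (Set.range act')) Wε) → w ∈ Eτ := by
      intro w hw
      rw [hEτ]
      exact hτc w (by rw [← hcc]; exact hw)
    -- an automorphism `θ` with `θ ∘ τ = τ₀`, and its transport
    obtain ⟨θ, hθ⟩ := Literature.FieldTheory.AlgClosed.exists_ringEquiv_apply_eq hΩ hR₀ τ τ₀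
    obtain ⟨Θ, Θ', hΘ'Θ, hΘΘ', hΘact, hΘ'act⟩ :=
      T.exists_semilinear_transport_blockCarrier K iW hiW act' hact ψ c hc hW θ
    haveI : RingHomSurjective (θ.symm : AlgebraicClosure ℚ_[ℓ] →+* AlgebraicClosure ℚ_[ℓ]) := ⟨θ.symm.surjective⟩
    -- (k1) `Θ` carries `Eτ` into `N₀`; (k2) `Θ′` carries `N₀` into `Eτ`
    have k1 : ∀ w ∈ Eτ, Θ w ∈ N₀ := by
      intro w hw
      refine T.mem_omegaBlock_of_forall_eigen K hI X hX ι ρW hf σ hσ iW hiW act' hact hHK hssM hf0 hεH hsel φ hφmul hφ1 hφH hφc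
        hφsurj hm1 N₀ hN0 hN₀mem τ₀ hτ₀ fun r => ?_
      rw [← hΘact, (hEτ w).1 hw r, LinearMap.map_smulₛₗ, RingHom.coe_coe, hθ]
    have k2 : ∀ n ∈ N₀, Θ' n ∈ Eτ := by
      intro n hn
      rw [hEτ]
      intro r
      rw [← hΘ'act, hτ₀ r n hn, LinearMap.map_smulₛₗ, RingHom.coe_coe, ← hθ, RingEquiv.symm_apply_apply]
    have hmapEq : (N₀.restrictScalars (AlgebraicClosure ℚ_[ℓ])).map Θ' = Eτ := by
      refine le_antisymm ?_ fun w hw => ?_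
      · rintro _ ⟨n, hn, rfl⟩
        exact k2 n hn
      · exact ⟨Θ w, k1 w hw, hΘ'Θ w⟩
    -- (k3) `Eτ` has no non-zero proper `act′`-stable subspace (transport from `N₀` along `Θ′`)
    have k3 : ∀ U : Submodule (AlgebraicClosure ℚ_[ℓ]) Wε, U ≤ Eτ → (∀ s ∈ Set.range act', ∀ u ∈ U, s u ∈ U) → U = ⊥ ∨ U = Eτ := by
      intro U hU hUS
      rw [← hmapEq] at hU ⊢
      exact Literature.RingTheory.SimpleModule.eq_bot_or_eq_map_of_forall_stable Θ' (S := Set.range act') (S' := Set.range act')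
        (N₀.restrictScalars (AlgebraicClosure ℚ_[ℓ])) hN₀stab hN₀noproper
        (fun s hs => ⟨s, hs, fun w _ => by obtain ⟨h, rfl⟩ := hs; exact hΘ'act h w⟩) U hU hUS
    -- (k4) `cc = Eτ`
    have hccstab : ∀ s ∈ Set.range act',
        ∀ u ∈ (cc : Submodule ↥(Algebra.adjoin (AlgebraicClosure ℚ_[ℓ]) (Set.range act')) Wε).restrictScalars (AlgebraicClosure ℚ_[ℓ]),
          s u ∈ (cc : Submodule ↥(Algebra.adjoin (AlgebraicClosure ℚ_[ℓ]) (Set.range act')) Wε).restrictScalars (AlgebraicClosure ℚ_[ℓ]) :=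
      Literature.NumberTheory.Automorphic.forall_mem_restrictScalars_of_submodule_adjoin (Set.range act') _
    have k4 : (cc : Submodule ↥(Algebra.adjoin (AlgebraicClosure ℚ_[ℓ]) (Set.range act')) Wε).restrictScalars (AlgebraicClosure ℚ_[ℓ]) = Eτ := by
      rcases k3 _ (fun w hw => hccE w hw) hccstab with h | h
      · exact absurd ((Submodule.restrictScalars_eq_bot_iff _ _ _).1 h) hcc0
      · exact h
    refine ⟨?_, ?_⟩
    · -- (k5) simplicity of `cc`
      refine Literature.RingTheory.SimpleModule.isSimpleModule_of_forall_stable (Set.range act') _ hcc0 fun U hU hUS => ?_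
      have hU' : U ≤ Eτ := fun u hu => hccE u (hU hu)
      rcases k3 U hU' hUS with h | h
      · exact Or.inl h
      · right
        rw [h, ← k4]
        rfl
    · -- (k6) `dim cc = dim N₀` along the `θ`-semilinear bijection `Θ : Eτ → N₀`
      have hmemcc : ∀ w, w ∈ (cc : Submodule ↥(Algebra.adjoin (AlgebraicClosure ℚ_[ℓ]) (Set.range act')) Wε) ↔ w ∈ Eτ := fun w => by
        rw [← k4]; rfl
      let e : ↥(cc : Submodule ↥(Algebra.adjoin (AlgebraicClosure ℚ_[ℓ]) (Set.range act')) Wε) ≃+ ↥N₀ :=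
        { toFun := fun x => ⟨Θ x.1, k1 _ ((hmemcc _).1 x.2)⟩
          invFun := fun y => ⟨Θ' y.1, (hmemcc _).2 (k2 _ y.2)⟩
          left_inv := fun x => Subtype.ext (hΘ'Θ x.1)
          right_inv := fun y => Subtype.ext (hΘΘ' y.1)
          map_add' := fun x y => Subtype.ext (map_add Θ x.1 y.1) }
      have hrank := rank_eq_of_equiv_equiv (θ : AlgebraicClosure ℚ_[ℓ] → AlgebraicClosure ℚ_[ℓ]) e θ.bijective
        (fun z x => Subtype.ext (by
          change Θ (z • x.1) = θ z • Θ x.1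
          rw [LinearMap.map_smulₛₗ, RingHom.coe_coe]))
      change Cardinal.toNat _ = Cardinal.toNat _
      rw [hrank]
  exact Literature.RingTheory.SimpleModule.finrank_center_mul_finrank_adjoin_eq_sq_of_multiplicityFree act'
    (fun cc => (key cc).1) (fun cc => (key cc).2)

end Assembly

end Characters

end Sec42Data.HeckeTranslates

/-! ## §6 The (MO) socket: `exists_block_multOne` (binder list = A-p11 probe v9 `SocketMultOne`, frozen head of the cell) -/

namespace Sec42Data.HeckeTranslates

/-- **THE (MO) PRODUCER `exists_block_multOne`** ([Liu2021] Prop. D.4 (1) «multiplicity one» read on the `ε`-block of the Hecke image, App. D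
§D.4 p. 140).  For a §4.2 datum with translates `T`, injective étale pull-backs `hI`, a Hecke datum `X` induced by `T`, an IRREDUCIBLE `ω` with a
non-zero `f ∈ Hom_G(ι∘ω, ℚ̄_ℓ ⊗ H¹_ét(A_∞))` (`hf`, `hf0`), `σ = 1 ⊗ rhoEt` SEMISIMPLE, row (D) `hD`, a centrally primitive central idempotent `ε` of
`H = heckeImage K` selecting the classes of `f(ω^K)` (`hsel`), a `ℚ`-form `(ψ, c, hc)` of `V_ℓ(A_K)` (★ `exists_ratRep_tateComparison`), and MULTIPLICITY
ONE `hm1` («every element of `Hom_G` is a multiple of `f`»): there is a model `W_ε ↪ ℚ̄_ℓ ⊗ H¹_ét(A_K)^∨∨` of the `ε`-block `range (ᵗV_ℓ^ℚ ε ⊗ 1)`, stable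
under the transposed Hecke action `act′`, with `dim Z(ℚ̄_ℓ⟨act′⟩) · dim ℚ̄_ℓ⟨act′⟩ = (dim W_ε)²` — the `hMO` hypothesis of ★
`BlockDimensionIdentityOfTateComparison.finrank_mul_finrank_range_eq_sq_of_exists_block` verbatim.  Assembly: free model (★ `exists_blockCarrier`),
block field of the centrally primitive `ε` (★ `exists_centreBlockField_of_isSemisimpleRing` over ★ `isSemisimpleRing_heckeImage_of_isSemisimpleRepresentation`),
★ `finrank_center_mul_finrank_adjoin_blockCarrier_eq_sq`.  Cell hodgecm-mathlib, crux HLiu418 (stmt-HodgeConjecture-24832), d6 registered stub `stub_MO`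
(count-neutral support: HC_CM is proved only modulo the 7 printed citations until rung 0 closes).
[cite: Liu2021, Prop. D.4 (1) (p. 130) and App. D §D.4 pp. 139–140 (FJcycle.tex l. 5626–5631)]
[cite: Lorenz2008, Ch. 28 F20 (Jacobson density with Schur's lemma)] [cite: Lam2001FirstCourse, §22 Prop. (22.1)–(22.2) (pp. 327–328)] -/
theorem exists_block_multOne {C : Sec42Data P5 isotropicAt} (T : C.HeckeTranslates) {ℓ : ℕ} [Fact ℓ.Prime] (K : C5.SmallLevel C.S.K₀)
    (hI : ∀ ⦃K K' : C5.SmallLevel C.S.K₀⦄ (f : K' ⟶ K), Function.Injective (rationalTateModuleMap ℓ (C.Atr f)).dualMap)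
    (X : C.EtaleHeckeDatum ℓ) (hX : X.rhoEt = T.etHeckeRep ℓ) (ι : ℂ ≃+* AlgebraicClosure ℚ_[ℓ])
    {W : Type} [AddCommGroup W] [Module ℂ W] (ρW : Representation ℂ C.G W) [ρW.IsIrreducible]
    {f : W →ₛₗ[(ι : ℂ →+* AlgebraicClosure ℚ_[ℓ])] AlgebraicClosure ℚ_[ℓ] ⊗[ℚ_[ℓ]] C.etaleH1Tower ℓ} (hf : f ∈ X.omegaHom ι ρW)
    (hf0 : ∃ w ∈ ρW.fixedPoints (K.1.1 : Subgroup C.G), f w ≠ 0)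
    (σ : Representation (AlgebraicClosure ℚ_[ℓ]) C.G (AlgebraicClosure ℚ_[ℓ] ⊗[ℚ_[ℓ]] C.etaleH1Tower ℓ))
    (hσ : ∀ g : C.G, σ g = (X.rhoEt g).baseChange (AlgebraicClosure ℚ_[ℓ]))
    (hD : T.IsogenyDescent) (hHK : IsSemisimpleRing ↥(T.heckeImage hD K))
    (hssM : ∀ K' : C5.SmallLevel C.S.K₀,
      IsSemisimpleModule ↥(Algebra.adjoin (AlgebraicClosure ℚ_[ℓ])
        ((Set.range fun g : C.G => ((rationalTateAction (C.A K') ℓ (T.heckeEnd hD K' g)).dualMap).baseChange (AlgebraicClosure ℚ_[ℓ])) :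
          Set (Module.End (AlgebraicClosure ℚ_[ℓ]) (AlgebraicClosure ℚ_[ℓ] ⊗[ℚ_[ℓ]] C.etaleH1 ℓ K'))))
        (AlgebraicClosure ℚ_[ℓ] ⊗[ℚ_[ℓ]] C.etaleH1 ℓ K'))
    {ε : (C.A K).endAlgebra} (hεH : ε ∈ T.heckeImage hD K)
    (hεcp : Literature.RingTheory.Idempotents.IsCentrallyPrimitive (⟨ε, hεH⟩ : ↥(T.heckeImage hD K)))
    (hεc : ∀ h ∈ T.heckeImage hD K, ε * h = h * ε)
    (hsel : ∀ w ∈ ρW.fixedPoints (K.1.1 : Subgroup C.G), ∀ x : (AlgebraicClosure ℚ_[ℓ]) ⊗[ℚ_[ℓ]] C.etaleH1 ℓ K,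
        (C.toTower ℓ K).baseChange (AlgebraicClosure ℚ_[ℓ]) x = f w →
          (C.toTower ℓ K).baseChange (AlgebraicClosure ℚ_[ℓ])
            (((rationalTateAction (C.A K) ℓ ε).dualMap).baseChange (AlgebraicClosure ℚ_[ℓ]) x) = f w)
    {κ : Type} [Fintype κ] [DecidableEq κ] (ψ : (C.A K).endAlgebra →ₐ[ℚ] Matrix κ κ ℚ)
    (c : (κ → ℚ_[ℓ]) ≃ₗ[ℚ_[ℓ]] (C.A K).rationalTateModule ℓ)
    (hc : ∀ x : (C.A K).endAlgebra,
      (c : (κ → ℚ_[ℓ]) →ₗ[ℚ_[ℓ]] (C.A K).rationalTateModule ℓ) ∘ₗ Matrix.mulVecLin ((ψ x).map (algebraMap ℚ ℚ_[ℓ])) =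
        (rationalTateAction (C.A K) ℓ x : Module.End ℚ_[ℓ] ((C.A K).rationalTateModule ℓ)) ∘ₗ
          (c : (κ → ℚ_[ℓ]) →ₗ[ℚ_[ℓ]] (C.A K).rationalTateModule ℓ))
    (hm1 : ∀ f₁ ∈ X.omegaHom ι ρW, ∃ a : AlgebraicClosure ℚ_[ℓ], f₁ = a • f) :
    ∃ (Wε : Type) (_ : AddCommGroup Wε) (_ : Module (AlgebraicClosure ℚ_[ℓ]) Wε) (_ : Module ℚ Wε)
      (_ : IsScalarTower ℚ (AlgebraicClosure ℚ_[ℓ]) Wε)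
      (iW : Wε →ₗ[AlgebraicClosure ℚ_[ℓ]] AlgebraicClosure ℚ_[ℓ] ⊗[ℚ_[ℓ]] Module.Dual ℚ_[ℓ] ((C.A K).rationalTateModule ℓ))
      (act' : ↥(T.heckeImage hD K) → Module.End (AlgebraicClosure ℚ_[ℓ]) Wε),
      Function.Injective iW ∧
      LinearMap.range iW =
        LinearMap.range (((rationalTateAction (C.A K) ℓ ε : Module.End ℚ_[ℓ] ((C.A K).rationalTateModule ℓ)).dualMap).baseChange
          (AlgebraicClosure ℚ_[ℓ])) ∧
      (∀ (h : ↥(T.heckeImage hD K)) (w : Wε), iW (act' h w) =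
        ((rationalTateAction (C.A K) ℓ (h : (C.A K).endAlgebra) :
            Module.End ℚ_[ℓ] ((C.A K).rationalTateModule ℓ)).dualMap).baseChange (AlgebraicClosure ℚ_[ℓ]) (iW w)) ∧
      Module.finrank (AlgebraicClosure ℚ_[ℓ]) ↥(Algebra.adjoin (AlgebraicClosure ℚ_[ℓ]) (Set.range act') ⊓
          Subalgebra.centralizer (AlgebraicClosure ℚ_[ℓ])
            (Algebra.adjoin (AlgebraicClosure ℚ_[ℓ]) (Set.range act') : Set (Module.End (AlgebraicClosure ℚ_[ℓ]) Wε))) *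
        Module.finrank (AlgebraicClosure ℚ_[ℓ]) ↥(Algebra.adjoin (AlgebraicClosure ℚ_[ℓ]) (Set.range act')) =
      Module.finrank (AlgebraicClosure ℚ_[ℓ]) Wε ^ 2 := by
  classical
  haveI : IsSemisimpleRing ↥(T.heckeImage hD K) := hHK
  obtain ⟨R₀, _, _, φ, -, hφmul, hφ1, hφH, hφc, -, hφsurj⟩ :=
    Literature.RingTheory.Idempotents.exists_centreBlockField_of_isSemisimpleRing (T.heckeImage hD K) hεH hεcp
  have hε : IsIdempotentElem ε := congrArg Subtype.val hεcp.idem.eq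
  obtain ⟨d, iW, act', hiW, hW, hact⟩ := T.exists_blockCarrier (ℓ := ℓ) K hD hεc
  exact ⟨Fin d → AlgebraicClosure ℚ_[ℓ], inferInstance, inferInstance, inferInstance, inferInstance, iW, act', hiW, hW, hact,
    T.finrank_center_mul_finrank_adjoin_blockCarrier_eq_sq K hI X hX ι ρW hf σ hσ iW hiW act' hact hHK hssM hf0 hε hεH hsel φ
      hφmul hφ1 hφH hφc hφsurj ψ c hc hm1 hW⟩

end Sec42Data.HeckeTranslates

end Literature.NumberTheory.Automorphic.Liu2021.AppendixC
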